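import Summits.KontsevichZagierPeriods.KontsevichZagierPeriods.Theorems.SymplecticScissorsRealOnePeriodRelationsStubTransferTorsB
import Summits.KontsevichZagierPeriods.KontsevichZagierPeriods.Theorems.SymplecticScissorsRealOnePeriodRelationsStubTorsUnit
import Mathlib.Tactic.Module

/-!
# Crux `RealOnePeriodRelations` (stmt-KontsevichZagierPeriods-10042), line `nash-retraction-thin-strip`, reshape 10:
# transfer of symbols on `C_T` — the THIRD-KIND piece `ξ_t` via the torsion units (towards the lead's stub `stub_transferTors`)

Uniform transfer lemmas `transfer_*`: each standard piece `π` of a form on `C_T` comes with a finitely supported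
`V : PeriodSymbol →₀ ℂ` with algebraic coefficients, supported on symbols on `E_L`, `𝔾ₘ = {xy = 1}` and `𝔸¹`, such that
`(C_T, π, γ) − V` lies in the `ℚ̄`-span of the elementary relations:

* `transfer_Theta0`, `transfer_Theta1`, `transfer_dlogV`, `transfer_exact`, `transfer_vanish` (from `…StubTransferTorsA`);
* `transfer_Xi` — the third-kind form `ξ_t = dx/((x − t) y)` at a torsion abscissa `t = ℘(v)`:
  - if `2v ∈ Λ` (`f(t) = 0`): `ξ_t` is of the second kind (`vanishesOn_xi_twoTorsion`), a combination of `θ₀, θ₁` on `E_L` and `𝟙`;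
  - if `2v ∉ Λ`: with the torsion units `G_±` of `stub_torsUnit` and the unit maps
    `Φ_± = (G_±, c⁻¹ G_∓ (x − t)^{−N}) : C_T → 𝔾ₘ`, the identity `dlog G₊ − dlog G₋ = (N ℘′(v)/2) ξ_t − λ θ₀` on `C_T`
    (`vanishesOn_xi_unit`) makes `(C_T, ξ_t, γ)` a combination of the logarithm symbols `(𝔾ₘ, y dx, Φ_± ∘ γ)` and
    `(E_L, θ₀, ι ∘ γ)` — the torsion trick for periods of the third kind.

[cite: HuberWustholz2022, §13.1 (B), §13.2, §18.1] [cite: SilvermanAEC2009, III.3.5]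
-/

noncomputable section

open scoped BigOperators Topology PeriodPair
open Set Filter MvPolynomial Complex
open Literature.NumberTheory.Transcendental Literature.NumberTheory.Transcendental.CurvePeriods
open Literature.NumberTheory.Transcendental.CurvePeriods.Ell

namespace Summit.KontsevichZagierPeriods.SymplecticScissors.RealOnePeriodRelations

namespace TorsionLayer

variable (L : PeriodPair)

/-! ### The third-kind piece `ξ_t` at a torsion abscissa of order `≥ 3`: the unit maps `Φ_± : C_T → 𝔾ₘ` -/

/-- **The unit map** `Φ = (G ∘ ι, c⁻¹ (G′ ∘ ι) (x − t)^{−N}) : C_T → 𝔸²` (lands in `𝔾ₘ = {xy = 1}` when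
`G G′ = c (x − t)^N` on `E_L`). [cite: SilvermanAEC2009, III.3.5] -/
def unitMap (T : Finset ℂ) (t : ℂ) (N : ℕ) (c : ℂ) (G G' : MvPolynomial (Fin 2) ℂ) : Fin 2 → MvPolynomial (Fin 3) ℂ :=
  ![bind₁ iota G, C c⁻¹ * bind₁ iota G' * invX T t ^ N]

/-- `bind₁` along a map over `ℚ̄` preserves algebraic coefficients. [folklore] -/
theorem hasAlgCoeffs_bind₁_iota {G : MvPolynomial (Fin 2) ℂ} (hG : HasAlgCoeffs G) : HasAlgCoeffs (bind₁ iota G) := by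
  have hω' : ∀ j, HasAlgCoeffs ((![G, 0] : Fin 2 → MvPolynomial (Fin 2) ℂ) j) := by
    intro j
    fin_cases j
    · simpa using hG
    · simpa using hasAlgCoeffs_zero (n := 2)
  have h := HasAlgCoeffs.formPullback (f := iota) (ω' := ![G, 0]) hasAlgCoeffs_iota hω' 0
  simpa [formPullback, Fin.sum_univ_two, iota, pderiv_X] using h

/-- The unit map is over `ℚ̄`. [folklore] -/
theorem hasAlgCoeffs_unitMap {T : Finset ℂ} (hT : ∀ a ∈ T, IsAlgebraic ℚ a) (t : ℂ) (N : ℕ) {c : ℂ} (hc : IsAlgebraic ℚ c)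
    {G G' : MvPolynomial (Fin 2) ℂ} (hG : HasAlgCoeffs G) (hG' : HasAlgCoeffs G') :
    ∀ j, HasAlgCoeffs (unitMap T t N c G G' j) := by
  intro j
  simp only [unitMap]
  fin_cases j
  · simpa using hasAlgCoeffs_bind₁_iota hG
  · simpa using ((hasAlgCoeffs_C hc.inv).mul (hasAlgCoeffs_bind₁_iota hG')).mul ((hasAlgCoeffs_invX hT t).pow N)

/-- `(G ∘ ι)(ψ_T z) = G(φ z)`. [folklore] -/
theorem eval_bind₁_iota_psiP (T : Finset ℂ) (G : MvPolynomial (Fin 2) ℂ) (z : ℂ) :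
    eval (psiP L T z) (bind₁ iota G) = eval (phi L z) G := by
  rw [eval_bind₁, iota_psiP]

/-- `(G ∘ ι)(q) = G(q₀, q₁)`. [folklore] -/
theorem eval_bind₁_iota_eq (G : MvPolynomial (Fin 2) ℂ) (q : Fin 3 → ℂ) :
    eval q (bind₁ iota G) = eval ![q 0, q 1] G := by
  rw [eval_bind₁, iota_eval]

/-- **The unit map lands in `𝔾ₘ`** when `G G′ = c (℘ − t)^N` along `φ` (`c ≠ 0`, `t ∈ T`). [cite: SilvermanAEC2009, III.3.5] -/
theorem unitMap_mapsTo : ∀ (L : PeriodPair) {T : Finset ℂ} {t : ℂ}, t ∈ T → ∀ {N : ℕ} {c : ℂ}, c ≠ 0 → ∀ {G G' : MvPolynomial (Fin 2) ℂ}, (∀ z : ℂ, z ∉ L.lattice → eval (phi L z) G * eval (phi L z) G' = c * (℘[L] z - t) ^ N) → ∀ q ∈ (curveP L T).points, (fun j => eval q (unitMap T t N c G G' j)) ∈ (⟨2, 1, ![X 0 * X 1 - 1]⟩ : CurveData).points := by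
  intro L T t ht N c hc G G' hprod q hq
  obtain ⟨z, hz, hne, rfl⟩ := exists_psiP_eq L T hq
  have hzt : ℘[L] z - t ≠ 0 := sub_ne_zero.2 ((prodFun_ne_zero_iff L T z).1 hne t ht)
  rw [mem_points_mulGroup_iff]
  simp only [unitMap, Matrix.cons_val_zero, Matrix.cons_val_one, map_mul, map_pow, eval_C, eval_bind₁_iota_psiP,
    eval_invX_psiP L ht hne]
  have h := hprod z hz
  rw [inv_pow]
  have hpow : (℘[L] z - t) ^ N ≠ 0 := pow_ne_zero _ hzt
  field_simp
  linear_combination h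

/-- The pairing of `Φ^*(y dx)` with `ψ_T′(z)`: `c⁻¹ G′(φ z) (℘ z − t)^{−N} · d/dz G(φ z)`. [folklore] -/
theorem unitMap_pair_psiPD {T : Finset ℂ} {t : ℂ} (ht : t ∈ T) (N : ℕ) (c : ℂ) (G G' : MvPolynomial (Fin 2) ℂ)
    {z : ℂ} (hz : z ∉ L.lattice) (hne : prodFun L T z ≠ 0) :
    ∑ i, eval (psiP L T z) (formPullback (unitMap T t N c G G') ![X 1, 0] i) * psiPD L T z i =
      c⁻¹ * eval (phi L z) G' * ((℘[L] z - t)⁻¹) ^ N * ∑ k, eval (phi L z) (pderiv k G) * phiD L z k := by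
  rw [formPullback_pair, Fin.sum_univ_two]
  simp only [Matrix.cons_val_zero, Matrix.cons_val_one, map_zero, zero_mul, add_zero, eval_X]
  have hD := hasDerivAt_eval_psiP L T hz hne (unitMap T t N c G G' 0)
  have hD' : HasDerivAt (fun w => eval (psiP L T w) (unitMap T t N c G G' 0))
      (∑ k, eval (phi L z) (pderiv k G) * phiD L z k) z := by
    have h := hasDerivAt_eval_phi L G hz
    refine h.congr_of_eventuallyEq (Filter.Eventually.of_forall fun w => ?_)
    simp [unitMap, eval_bind₁_iota_psiP]
  rw [hD.unique hD']
  simp only [unitMap, Matrix.cons_val_one, Matrix.cons_val_zero, map_mul, map_pow, eval_C, eval_bind₁_iota_psiP,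
    eval_invX_psiP L ht hne]

/-- **The dlog identity on `C_T`**: with the torsion units of `stub_torsUnit`,
`Φ₊^*(y dx) − Φ₋^*(y dx) − (N ℘′(v)/2) ξ_t + λ θ₀` vanishes on `C_T` (`t = ℘ v ∈ T`). [cite: WhittakerWatson1927, §20.53] -/
theorem vanishesOn_xi_unit {T : Finset ℂ} (hE : (curveP L T).IsSmoothAffineCurve) {t v : ℂ} (ht : t ∈ T) (hvt : ℘[L] v = t)
    {N : ℕ} {c lam : ℂ} (hc : c ≠ 0) {Gp Gm : MvPolynomial (Fin 2) ℂ}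
    (hprod : ∀ z : ℂ, z ∉ L.lattice → eval (phi L z) Gp * eval (phi L z) Gm = c * (℘[L] z - ℘[L] v) ^ N)
    (hdlog : ∀ z : ℂ, z ∉ L.lattice → ℘[L] z ≠ ℘[L] v →
      (∑ k, eval (phi L z) (pderiv k Gp) * phiD L z k) / eval (phi L z) Gp -
        (∑ k, eval (phi L z) (pderiv k Gm) * phiD L z k) / eval (phi L z) Gm =
          (N : ℂ) * ℘'[L] v / (℘[L] z - ℘[L] v) - 2 * lam) :
    VanishesOn (curveP L T)
      (formPullback (unitMap T t N c Gp Gm) ![X 1, 0] - formPullback (unitMap T t N c Gm Gp) ![X 1, 0] -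
        ((N : ℂ) * ℘'[L] v / 2) • Xi L T t + lam • Theta0 L) := by
  refine vanishesOn_curveP_of_psi L hE _ fun z hz hne => ?_
  subst hvt
  have hzt : ℘[L] z ≠ ℘[L] v := (prodFun_ne_zero_iff L T z).1 hne _ ht
  have hsub : ℘[L] z - ℘[L] v ≠ 0 := sub_ne_zero.2 hzt
  have hp := hprod z hz
  have hGp : eval (phi L z) Gp ≠ 0 := by
    intro h0; rw [h0, zero_mul] at hp; exact (mul_ne_zero hc (pow_ne_zero _ hsub)) hp.symm
  have hGm : eval (phi L z) Gm ≠ 0 := by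
    intro h0; rw [h0, mul_zero] at hp; exact (mul_ne_zero hc (pow_ne_zero _ hsub)) hp.symm
  have hsum : ∑ i, eval (psiP L T z) ((formPullback (unitMap T (℘[L] v) N c Gp Gm) ![X 1, 0] -
        formPullback (unitMap T (℘[L] v) N c Gm Gp) ![X 1, 0] -
        ((N : ℂ) * ℘'[L] v / 2) • Xi L T (℘[L] v) + lam • Theta0 L : Fin 3 → MvPolynomial (Fin 3) ℂ) i) * psiPD L T z i =
      (∑ i, eval (psiP L T z) (formPullback (unitMap T (℘[L] v) N c Gp Gm) ![X 1, 0] i) * psiPD L T z i) -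
        (∑ i, eval (psiP L T z) (formPullback (unitMap T (℘[L] v) N c Gm Gp) ![X 1, 0] i) * psiPD L T z i) -
        ((N : ℂ) * ℘'[L] v / 2) * (∑ i, eval (psiP L T z) (Xi L T (℘[L] v) i) * psiPD L T z i) +
        lam * (∑ i, eval (psiP L T z) (Theta0 L i) * psiPD L T z i) := by
    rw [← const_smul_pair, ← const_smul_pair, ← Finset.sum_sub_distrib, ← Finset.sum_sub_distrib,
      ← Finset.sum_add_distrib]
    refine Finset.sum_congr rfl fun i _ => ?_
    simp only [Pi.add_apply, Pi.sub_apply, map_add, map_sub]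
    ring
  rw [hsum, unitMap_pair_psiPD L ht N c Gp Gm hz hne, unitMap_pair_psiPD L ht N c Gm Gp hz hne,
    Xi_pair_psiPD L ht hz hne, Theta0_pair_psiPD L T hz]
  have hd := hdlog z hz hzt
  -- rewrite the two pairings as logarithmic derivatives using the product formula
  have hp' : eval (phi L z) Gm * eval (phi L z) Gp = c * (℘[L] z - ℘[L] v) ^ N := by rw [mul_comm]; exact hp
  have e1 : c⁻¹ * eval (phi L z) Gm * ((℘[L] z - ℘[L] v)⁻¹) ^ N = (eval (phi L z) Gp)⁻¹ := by
    rw [inv_pow]; field_simp; linear_combination hp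
  have e2 : c⁻¹ * eval (phi L z) Gp * ((℘[L] z - ℘[L] v)⁻¹) ^ N = (eval (phi L z) Gm)⁻¹ := by
    rw [inv_pow]; field_simp; linear_combination hp'
  rw [e1, e2, ← div_eq_inv_mul, ← div_eq_inv_mul, hd]
  field_simp
  ring

/-- **Transfer of `Φ^*(y dx)`**: `V = (𝔾ₘ, y dx, Φ ∘ γ)` ((R4) along the unit map). [cite: HuberWustholz2022, §13.1 (B)] -/
theorem transfer_unitMap (h₂ : IsAlgebraic ℚ L.g₂) (h₃ : IsAlgebraic ℚ L.g₃) {T : Finset ℂ} (hT : ∀ a ∈ T, IsAlgebraic ℚ a)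
    {t : ℂ} (ht : t ∈ T) {N : ℕ} {c : ℂ} (hc : c ≠ 0) (hca : IsAlgebraic ℚ c) {G G' : MvPolynomial (Fin 2) ℂ}
    (hG : HasAlgCoeffs G) (hG' : HasAlgCoeffs G')
    (hprod : ∀ z : ℂ, z ∉ L.lattice → eval (phi L z) G * eval (phi L z) G' = c * (℘[L] z - t) ^ N)
    (γ : CurvePath (curveP L T)) :
    ∃ V : PeriodSymbol →₀ ℂ, (∀ s, IsAlgebraic ℚ (V s)) ∧
      (∃ (k : ℕ) (ρ : Fin k → (PeriodSymbol →₀ ℂ)) (a : Fin k → ℂ),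
      (∀ l, IsElementaryRelation (ρ l)) ∧ (∀ l, IsAlgebraic ℚ (a l)) ∧ (Finsupp.single (⟨curveP L T, smoothP L h₂ h₃ hT, formPullback (unitMap T t N c G G') ![X 1, 0],
        HasAlgCoeffs.formPullback (hasAlgCoeffs_unitMap hT t N hca hG hG') hasAlgCoeffs_ydx, γ⟩ : PeriodSymbol) (1 : ℂ) - V) = ∑ l, a l • ρ l) ∧
      ∀ s ∈ V.support, (s.Z = curve L ∨ s.Z = (⟨2, 1, ![X 0 * X 1 - 1]⟩ : CurveData) ∨ s.Z = CurveData.affineLine) := by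
  have hf := hasAlgCoeffs_unitMap hT t N hca hG hG'
  have hfZ := unitMap_mapsTo L ht hc hprod
  obtain ⟨γ', hγ'⟩ := RetractionPaths.exists_mapPath (Z := curveP L T) (Z' := ⟨2, 1, ![X 0 * X 1 - 1]⟩)
    (unitMap T t N c G G') hf hfZ γ
  have rel := IsElementaryRelation.pushforward (curveP L T) ⟨2, 1, ![X 0 * X 1 - 1]⟩ (smoothP L h₂ h₃ hT)
    isSmoothAffineCurve_mulGroup (unitMap T t N c G G') hf hfZ ![X 1, 0] hasAlgCoeffs_ydx _
    (HasAlgCoeffs.formPullback hf hasAlgCoeffs_ydx) rfl γ γ' (fun s _ => by rw [hγ' s])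
  refine ⟨Finsupp.single (⟨⟨2, 1, ![X 0 * X 1 - 1]⟩, isSmoothAffineCurve_mulGroup, ![X 1, 0], hasAlgCoeffs_ydx, γ'⟩ :
    PeriodSymbol) 1, fun s => isAlgebraic_single_apply_of _ _ isAlgebraic_one, span_of_rel rel, fun s hs => ?_⟩
  rw [Finsupp.support_single _ one_ne_zero, Finset.mem_singleton] at hs
  subst hs
  exact Or.inr (Or.inl rfl)

/-- **Transfer of `ξ_t` at a torsion abscissa `t = ℘ v` with `2v ∉ Λ`** — the torsion trick for the third kind:
`ξ_t = κ (Φ₊^*(y dx) − Φ₋^*(y dx) + λ θ₀ − ν)`, `κ = 2/(N ℘′(v))`. [cite: HuberWustholz2022, §13.2] [cite: SilvermanAEC2009, III.3.5] -/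
theorem transfer_Xi_unit (h₂ : IsAlgebraic ℚ L.g₂) (h₃ : IsAlgebraic ℚ L.g₃) {T : Finset ℂ} (hT : ∀ a ∈ T, IsAlgebraic ℚ a)
    {t v : ℂ} (ht : t ∈ T) (hv : IsAlgPt L v) (hvt : ℘[L] v = t) {N : ℕ} (hN : 1 ≤ N) (hNv : (N : ℂ) * v ∈ L.lattice)
    (h2v : 2 * v ∉ L.lattice) (γ : CurvePath (curveP L T)) :
    ∃ V : PeriodSymbol →₀ ℂ, (∀ s, IsAlgebraic ℚ (V s)) ∧
      (∃ (k : ℕ) (ρ : Fin k → (PeriodSymbol →₀ ℂ)) (a : Fin k → ℂ),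
      (∀ l, IsElementaryRelation (ρ l)) ∧ (∀ l, IsAlgebraic ℚ (a l)) ∧ (Finsupp.single (⟨curveP L T, smoothP L h₂ h₃ hT, Xi L T t, hasAlgCoeffs_Xi L h₂ h₃ hT t, γ⟩ : PeriodSymbol) (1 : ℂ) - V) = ∑ l, a l • ρ l) ∧
      ∀ s ∈ V.support, (s.Z = curve L ∨ s.Z = (⟨2, 1, ![X 0 * X 1 - 1]⟩ : CurveData) ∨ s.Z = CurveData.affineLine) := by
  classical
  have hE := smoothP L h₂ h₃ hT
  obtain ⟨Gp, Gm, c, lam, hGp, hGm, hca, hc, hlam, hprod, hdlog⟩ := stub_torsUnit L h₂ h₃ hv hN hNv h2v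
  -- `℘′(v) ≠ 0` and the scalar `κ`
  have hy : ℘'[L] v ≠ 0 := L.derivWeierstrassP_ne_zero hv.1 h2v
  have hNy : (N : ℂ) * ℘'[L] v / 2 ≠ 0 := by
    have hN0 : (N : ℂ) ≠ 0 := by exact_mod_cast (Nat.one_le_iff_ne_zero.1 hN)
    exact div_ne_zero (mul_ne_zero hN0 hy) two_ne_zero
  have hNya : IsAlgebraic ℚ ((N : ℂ) * ℘'[L] v / 2) := by
    rw [div_eq_mul_inv]; exact ((isAlgebraic_nat N).mul hv.derivWeierstrassP).mul (isAlgebraic_nat 2).inv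
  have hprod' : ∀ z : ℂ, z ∉ L.lattice → eval (phi L z) Gp * eval (phi L z) Gm = c * (℘[L] z - t) ^ N := by
    intro z hz; rw [← hvt]; exact hprod z hz
  have hprod'' : ∀ z : ℂ, z ∉ L.lattice → eval (phi L z) Gm * eval (phi L z) Gp = c * (℘[L] z - t) ^ N := by
    intro z hz; rw [mul_comm]; exact hprod' z hz
  -- the pieces
  set PBp := formPullback (unitMap T t N c Gp Gm) ![X 1, 0] with hPBp
  set PBm := formPullback (unitMap T t N c Gm Gp) ![X 1, 0] with hPBm
  have hPBpa : ∀ k, HasAlgCoeffs (PBp k) := HasAlgCoeffs.formPullback (hasAlgCoeffs_unitMap hT t N hca hGp hGm) hasAlgCoeffs_ydx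
  have hPBma : ∀ k, HasAlgCoeffs (PBm k) := HasAlgCoeffs.formPullback (hasAlgCoeffs_unitMap hT t N hca hGm hGp) hasAlgCoeffs_ydx
  have hΘ0 := hasAlgCoeffs_Theta0 L h₂ h₃
  have hXi := hasAlgCoeffs_Xi L h₂ h₃ hT t
  set VAN : Fin 3 → MvPolynomial (Fin 3) ℂ := PBp - PBm - ((N : ℂ) * ℘'[L] v / 2) • Xi L T t + lam • Theta0 L with hVAN
  have hVANv : VanishesOn (curveP L T) VAN := vanishesOn_xi_unit L hE ht hvt hc hprod hdlog
  have hVANa : ∀ k, HasAlgCoeffs (VAN k) := by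
    intro k
    simp only [hVAN, Pi.add_apply, Pi.sub_apply, Pi.smul_apply]
    exact (((hPBpa k).sub (hPBma k)).sub ((hXi k).smul hNya)).add ((hΘ0 k).smul hlam)
  let ω : Fin 4 → Fin 3 → MvPolynomial (Fin 3) ℂ := ![PBp, PBm, Theta0 L, VAN]
  set κ : ℂ := ((N : ℂ) * ℘'[L] v / 2)⁻¹ with hκ
  let cf : Fin 4 → ℂ := ![κ, -κ, κ * lam, -κ]
  have hκa : IsAlgebraic ℚ κ := hNya.inv
  have hω : ∀ i k, HasAlgCoeffs (ω i k) := by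
    intro i k
    fin_cases i
    · exact hPBpa k
    · exact hPBma k
    · exact hΘ0 k
    · exact hVANa k
  have hcf : ∀ i, IsAlgebraic ℚ (cf i) := by
    intro i
    fin_cases i
    · show IsAlgebraic ℚ κ
      exact hκa
    · show IsAlgebraic ℚ (-κ)
      exact hκa.neg
    · show IsAlgebraic ℚ (κ * lam)
      exact hκa.mul hlam
    · show IsAlgebraic ℚ (-κ)
      exact hκa.neg
  have heq : Xi L T t = ∑ i ∈ Finset.univ, cf i • ω i := by
    symm
    calc ∑ i ∈ Finset.univ, cf i • ω i
        = κ • PBp + (-κ) • PBm + (κ * lam) • Theta0 L + (-κ) • VAN := by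
          simp only [Fin.sum_univ_four, ω, cf, Matrix.cons_val_zero, Matrix.cons_val_one, Matrix.cons_val_two]
          abel
      _ = (κ * ((N : ℂ) * ℘'[L] v / 2)) • Xi L T t := by rw [hVAN]; module
      _ = Xi L T t := by rw [hκ, inv_mul_cancel₀ hNy, one_smul]
  refine transfer_combo L h₂ h₃ hT γ Finset.univ ω hω cf hcf (fun i _ => ?_) (Xi L T t) hXi heq
  fin_cases i
  · exact transfer_unitMap L h₂ h₃ hT ht hc hca hGp hGm hprod' γ
  · exact transfer_unitMap L h₂ h₃ hT ht hc hca hGm hGp hprod'' γ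
  · exact transfer_Theta0 L h₂ h₃ hT γ
  · exact transfer_vanish L h₂ h₃ hT hVANa hVANv γ

/-- **Transfer of the third-kind piece `ξ_t` at a torsion abscissa** (both cases). [cite: HuberWustholz2022, §13.2] -/
theorem transfer_Xi (h₂ : IsAlgebraic ℚ L.g₂) (h₃ : IsAlgebraic ℚ L.g₃) {T : Finset ℂ} (hT : ∀ a ∈ T, IsAlgebraic ℚ a)
    {t : ℂ} (ht : t ∈ T) (htors : ∃ v : ℂ, IsAlgPt L v ∧ (∃ n : ℕ, 1 ≤ n ∧ (n : ℂ) * v ∈ L.lattice) ∧ ℘[L] v = t)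
    (γ : CurvePath (curveP L T)) :
    ∃ V : PeriodSymbol →₀ ℂ, (∀ s, IsAlgebraic ℚ (V s)) ∧
      (∃ (k : ℕ) (ρ : Fin k → (PeriodSymbol →₀ ℂ)) (a : Fin k → ℂ),
      (∀ l, IsElementaryRelation (ρ l)) ∧ (∀ l, IsAlgebraic ℚ (a l)) ∧ (Finsupp.single (⟨curveP L T, smoothP L h₂ h₃ hT, Xi L T t, hasAlgCoeffs_Xi L h₂ h₃ hT t, γ⟩ : PeriodSymbol) (1 : ℂ) - V) = ∑ l, a l • ρ l) ∧
      ∀ s ∈ V.support, (s.Z = curve L ∨ s.Z = (⟨2, 1, ![X 0 * X 1 - 1]⟩ : CurveData) ∨ s.Z = CurveData.affineLine) := by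
  obtain ⟨v, hv, ⟨n, hn, hnv⟩, hvt⟩ := htors
  by_cases h2v : 2 * v ∈ L.lattice
  · -- `t` is a `2`-torsion abscissa: `f(t) = 0`
    have hy : ℘'[L] v = 0 := (L.derivWeierstrassP_eq_zero_iff hv.1).2 h2v
    have hft : t ^ 3 + A L * t + B L = 0 := by
      have h := (Weier.mem_points_iff (A L) (B L) (phi L v)).1 (phi_mem_points L hv.1)
      rw [Weier.eval_fPoly] at h
      simp only [phi_apply_zero, phi_apply_one, hy, zero_div] at h
      rw [← hvt]
      linear_combination -h
    exact transfer_Xi_two L h₂ h₃ hT ht hft γ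
  · exact transfer_Xi_unit L h₂ h₃ hT ht hv hvt hn hnv h2v γ

end TorsionLayer

end Summit.KontsevichZagierPeriods.SymplecticScissors.RealOnePeriodRelations

end
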